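import Literature.Analysis.Calculus.IteratedFDerivParametricIntegral
import HarnessLib

/-!
# Iterated differentiation under the integral sign: set integrals

Analysis/Calculus support file (everything proved, theorems only). The set-integral form of
`Literature.Analysis.Calculus.iteratedFDeriv_integral_eq` /
`contDiff_integral_of_dominated_iteratedFDeriv` (Hörmander, *ALPDO I*, Thm. 1.1.9): for a family
`H : A → P → F` which is smooth *for `a` in a measurable set `S`*, with `a ↦ Dⁿ(H a)(p)`
a.e.-strongly measurable on `μ|S` and `‖Dⁿ(H a)(p)‖ ≤ gₙ a` for `a ∈ S`, `gₙ` integrable on `S`,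
the set integral `p ↦ ∫_{a ∈ S} H a p dμ` is `C^∞`, with
`Dⁿ ∫_S H a dμ = ∫_S Dⁿ (H a) dμ` and `‖Dⁿ ∫_S H a dμ‖ ≤ ∫_S gₙ dμ`. Nothing is assumed about
`H a` for `a ∉ S` (reduction to the whole-space statement by replacing `H a` with `0` off `S`).
This is the form used for time integrals `∫₀ᵗ` of slice-smooth integrands which are only
controlled on `[0, T]`.

## References

* L. Hörmander, *The Analysis of Linear Partial Differential Operators I*, 2nd ed. (1990),
  Thm. 1.1.9.
-/

noncomputable section

open MeasureTheory Set Filter Function Metric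
open scoped Topology ContDiff

namespace Literature.Analysis.Calculus

variable {A : Type*} [MeasurableSpace A] {μ : Measure A}
variable {P : Type*} [NormedAddCommGroup P] [NormedSpace ℝ P]
variable {F : Type*} [NormedAddCommGroup F] [NormedSpace ℝ F] [CompleteSpace F]

/-- **Iterated differentiation under a set integral.** Let `S` be measurable and `H : A → P → F`
be such that `H a` is smooth for `a ∈ S`, `a ↦ Dⁿ(H a)(p)` is a.e.-strongly measurable for
`μ|S`, and `‖Dⁿ(H a)(p)‖ ≤ gₙ a` for `a ∈ S` and all `p`, with `gₙ` integrable on `S`. Then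
`p ↦ ∫_{a ∈ S} H a p dμ` is `C^∞`, `Dⁿ ∫_S H a dμ (p) = ∫_S Dⁿ(H a)(p) dμ`, and
`‖Dⁿ ∫_S H a dμ (p)‖ ≤ ∫_S gₙ dμ` for any such bound. [folklore] -/
theorem contDiff_setIntegral_of_dominated_iteratedFDeriv {S : Set A} (hS : MeasurableSet S)
    {H : A → P → F} (h1 : ∀ a ∈ S, ContDiff ℝ ∞ (H a))
    (h2 : ∀ (n : ℕ) (p : P), AEStronglyMeasurable (fun a => iteratedFDeriv ℝ n (H a) p) (μ.restrict S))
    (h3 : ∀ n : ℕ, ∃ g : A → ℝ, IntegrableOn g S μ ∧ ∀ a ∈ S, ∀ p, ‖iteratedFDeriv ℝ n (H a) p‖ ≤ g a) :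
    ContDiff ℝ ∞ (fun p => ∫ a in S, H a p ∂μ) ∧
    (∀ (n : ℕ) (p : P), iteratedFDeriv ℝ n (fun p => ∫ a in S, H a p ∂μ) p =
      ∫ a in S, iteratedFDeriv ℝ n (H a) p ∂μ) ∧
    (∀ (n : ℕ) (p : P) (g : A → ℝ), IntegrableOn g S μ → (∀ a ∈ S, ‖iteratedFDeriv ℝ n (H a) p‖ ≤ g a) →
      ‖iteratedFDeriv ℝ n (fun p => ∫ a in S, H a p ∂μ) p‖ ≤ ∫ a in S, g a ∂μ) := by
  classical
  -- replace `H a` by `0` off `S`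
  set H' : A → P → F := fun a => if a ∈ S then H a else 0 with hH'
  have hH'S : ∀ a ∈ S, H' a = H a := fun a ha => by simp [hH', ha]
  have hH'n : ∀ a ∉ S, H' a = 0 := fun a ha => by simp [hH', ha]
  have hD : ∀ (n : ℕ) (a : A) (p : P), iteratedFDeriv ℝ n (H' a) p =
      S.indicator (fun a => iteratedFDeriv ℝ n (H a) p) a := by
    intro n a p
    by_cases ha : a ∈ S
    · rw [indicator_of_mem ha, hH'S a ha]
    · rw [indicator_of_notMem ha, hH'n a ha]
      simp
  have hint : ∀ p, (∫ a in S, H a p ∂μ) = ∫ a, H' a p ∂(μ.restrict S) := fun p =>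
    setIntegral_congr_fun hS fun a ha => by rw [hH'S a ha]
  have hintD : ∀ (n : ℕ) (p : P), (∫ a in S, iteratedFDeriv ℝ n (H a) p ∂μ) =
      ∫ a, iteratedFDeriv ℝ n (H' a) p ∂(μ.restrict S) := fun n p =>
    setIntegral_congr_fun hS fun a ha => by rw [hH'S a ha]
  -- the hypotheses of the whole-space statement for `H'` and `μ|S`
  have h1' : ∀ a, ContDiff ℝ ∞ (H' a) := fun a => by
    by_cases ha : a ∈ S
    · rw [hH'S a ha]; exact h1 a ha
    · rw [hH'n a ha]; exact contDiff_const
  have h2' : ∀ (n : ℕ) (p : P), AEStronglyMeasurable (fun a => iteratedFDeriv ℝ n (H' a) p) (μ.restrict S) := by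
    intro n p
    have heq : (fun a => iteratedFDeriv ℝ n (H' a) p) = S.indicator fun a => iteratedFDeriv ℝ n (H a) p :=
      funext fun a => hD n a p
    rw [heq]
    exact (h2 n p).indicator hS
  have h3' : ∀ n : ℕ, ∃ g : A → ℝ, Integrable g (μ.restrict S) ∧ ∀ a p, ‖iteratedFDeriv ℝ n (H' a) p‖ ≤ g a := by
    intro n
    obtain ⟨g, hg, hb⟩ := h3 n
    refine ⟨S.indicator g, hg.congr (indicator_ae_eq_restrict hS).symm, fun a p => ?_⟩
    · rw [hD]
      by_cases ha : a ∈ S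
      · rw [indicator_of_mem ha, indicator_of_mem ha]; exact hb a ha p
      · rw [indicator_of_notMem ha, indicator_of_notMem ha, norm_zero]
  have hfun : (fun p => ∫ a in S, H a p ∂μ) = fun p => ∫ a, H' a p ∂(μ.restrict S) := funext hint
  refine ⟨?_, fun n p => ?_, fun n p g hg hb => ?_⟩
  · rw [hfun]; exact contDiff_integral_of_dominated_iteratedFDeriv h1' h2' h3'
  · rw [hfun, iteratedFDeriv_integral_eq h1' h2' h3', hintD]
  · rw [hfun, iteratedFDeriv_integral_eq h1' h2' h3']
    calc ‖∫ a, iteratedFDeriv ℝ n (H' a) p ∂(μ.restrict S)‖ ≤ ∫ a, S.indicator g a ∂(μ.restrict S) := by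
          refine norm_integral_le_of_norm_le (hg.congr (indicator_ae_eq_restrict hS).symm)
            (Eventually.of_forall fun a => ?_)
          rw [hD]
          by_cases ha : a ∈ S
          · rw [indicator_of_mem ha, indicator_of_mem ha]; exact hb a ha
          · rw [indicator_of_notMem ha, indicator_of_notMem ha, norm_zero]
      _ = ∫ a in S, g a ∂μ := by
          rw [integral_indicator hS, Measure.restrict_restrict hS, inter_self]

end Literature.Analysis.Calculus

end
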